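import Summits.ResolutionOfSingularities.ResolutionOfSingularities.Theorems.FrobeniusClosingPatchingRelPerfectMonomialGamePrincipalization
import HarnessLib

/-!
# Crux `PatchingRelPerfect` (stmt-ResolutionOfSingularities-16161), chain w52 — M2-strong, SCHEME DICTIONARY
# part 6: removing repeated boundary entries, and **M2 BY NAME from the polyhedra game**

[OURS · L1 W5.2 · TargetsF3 (m) M2-strong] The dictionary theorem of part 5
(`monomialSumPrincipalization_of_game_of_nodup`) asks for a duplicate-free boundary list; the typed target
M2 `DepthTargets.MonomialSumPrincipalization` (p502939) does not.  This file PROVES the normalisation —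
`HasSNCWith` depends on the boundary list only through its members (`HasSNCWith.of_forall_mem_iff`),
collecting an exponent list onto the de-duplicated boundary keeps its monomial ideal
(`monomialIdeal_collect`) — and concludes

  **`monomialSumPrincipalization_of_game :
     PolyhedraGame.GlobalPermissiblePolyhedraGame → DepthTargets.MonomialSumPrincipalization`**,

so that R-mono (`DepthTargets.monomial_of_targets`, M1 ✓ M3 ✓ D5 ✓) is a tree theorem modulo
res-type-075's combinatorial target alone.  Fact-free; nothing here is a statement of the manuscript.

## References

* J. Kollár, *Lectures on Resolution of Singularities* (2007), (3.111) Step 3. [Kollar2007]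
* M. Spivakovsky, *A solution to Hironaka's polyhedra game* (1983). [Spivakovsky1983]
-/

-- `Summit.<Summit>.<Sub>.Theorems` with `Sub = Summit` (single-conjunct summit, D-0017)
set_option linter.dupNamespace false

noncomputable section

open CategoryTheory AlgebraicGeometry TopologicalSpace IsLocalRing
open Literature.AlgebraicGeometry.Resolution

namespace Summit.ResolutionOfSingularities.ResolutionOfSingularities.Theorems

namespace MonomialCleanup

open DepthTargets (monomialSum monomialSum_nil monomialSum_cons)

universe u

variable {X : Scheme.{u}}

/-! ## `HasSNCWith` only sees the members of the boundary list -/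

/-- **Simple normal crossings depends on the boundary list only through its set of members.** [folklore] -/
theorem HasSNCWith.of_forall_mem_iff {E E' : List X.IdealSheafData} {C : X.IdealSheafData}
    (h : ∀ D, D ∈ E' ↔ D ∈ E) (hE : HasSNCWith E C) : HasSNCWith E' C := by
  intro x
  obtain ⟨hreg, u, hu, ⟨ι, hinj, hι⟩, hC⟩ := hE x
  refine ⟨hreg, u, hu, ⟨fun D => ι ⟨D.1, (h D.1).mp D.2.1, D.2.2⟩, ?_, fun D => hι ⟨D.1, (h D.1).mp D.2.1, D.2.2⟩⟩, hC⟩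
  intro D₁ D₂ heq
  have h1 := congrArg (fun D : {D // D ∈ E ∧ x ∈ D.support} => D.1) (hinj heq)
  exact Subtype.ext h1

/-! ## Collecting an exponent list onto a duplicate-free boundary -/

/-- The exponent list on the boundary `Es₀` carrying, at each member `K`, the total exponent `expOf A K`.
[folklore] -/
def collect (Es₀ : List X.IdealSheafData) (A : List (X.IdealSheafData × ℕ)) : List (X.IdealSheafData × ℕ) :=
  Es₀.map fun K => (K, expOf A K)

/-- `collect` lives on `Es₀`. [folklore] -/
theorem boundaryOf_collect (Es₀ : List X.IdealSheafData) (A : List (X.IdealSheafData × ℕ)) :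
    boundaryOf (collect Es₀ A) = Es₀ := by
  simp [collect, boundaryOf, List.map_map, Function.comp_def]

open Classical in
/-- The exponents of a list `Es₀.map (K ↦ (K, f K))` on a duplicate-free `Es₀`. [folklore] -/
theorem expOf_map_of_nodup {Es₀ : List X.IdealSheafData} (hnd : Es₀.Nodup) (f : X.IdealSheafData → ℕ)
    (K : X.IdealSheafData) :
    expOf (Es₀.map fun L => (L, f L)) K = if K ∈ Es₀ then f K else 0 := by
  classical
  induction Es₀ with
  | nil => simp [expOf]
  | cons L t ih =>
    obtain ⟨hL, ht⟩ := List.nodup_cons.mp hnd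
    rw [List.map_cons, expOf_cons, ih ht]
    by_cases hKL : L = K
    · subst hKL
      rw [if_pos rfl, if_neg hL, if_pos (List.mem_cons_self ..)]
      simp
    · rw [if_neg hKL, zero_add]
      by_cases hKt : K ∈ t
      · rw [if_pos hKt, if_pos (List.mem_cons_of_mem _ hKt)]
      · rw [if_neg hKt, if_neg (by
          intro h
          rcases List.mem_cons.mp h with h | h
          · exact hKL h.symm
          · exact hKt h)]

open Classical in
/-- **Collecting keeps the monomial ideal** (the stalks are the same product over the distinct divisors).
[folklore] -/
theorem monomialIdeal_collect {Es : List X.IdealSheafData} {A : List (X.IdealSheafData × ℕ)}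
    (hA : boundaryOf A = Es) : monomialIdeal (collect Es.dedup A) = monomialIdeal A := by
  classical
  have hsh : sheaves (collect Es.dedup A) = sheaves A := by
    ext K
    rw [mem_sheaves_iff, mem_sheaves_iff, boundaryOf_collect, List.mem_dedup, hA]
  refine ext_of_forall_stalkIdeal_eq fun x => ?_
  rw [stalkIdeal_monomialIdeal_eq_finsetProd A (subset_refl _) x,
    stalkIdeal_monomialIdeal_eq_finsetProd (collect Es.dedup A) hsh.subset x]
  refine Finset.prod_congr rfl fun K hK => ?_
  rw [collect, expOf_map_of_nodup (List.nodup_dedup Es), if_pos]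
  rw [List.mem_dedup, ← hA]
  exact mem_sheaves_iff.mp hK

open Classical in
/-- Collecting every member keeps the sum. [folklore] -/
theorem monomialSum_map_collect {Es : List X.IdealSheafData} {𝒦 : List (List (X.IdealSheafData × ℕ))}
    (hb : ∀ A ∈ 𝒦, boundaryOf A = Es) :
    monomialSum (𝒦.map (collect Es.dedup)) = monomialSum 𝒦 := by
  induction 𝒦 with
  | nil => rfl
  | cons A 𝒦 ih =>
    rw [List.map_cons, monomialSum_cons, monomialSum_cons, monomialIdeal_collect (hb A (by simp)),
      ih fun B hB => hb B (List.mem_cons_of_mem _ hB)]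

/-! ## M2 by name from the game -/

open Classical in
/-- **Duplicate-free boundaries suffice for M2**: a principalization statement for duplicate-free snc
boundaries gives M2 `DepthTargets.MonomialSumPrincipalization` in general (collect the members onto the
de-duplicated boundary; the sum, hence the conclusion, is unchanged). [folklore] -/
theorem monomialSumPrincipalization_of_nodup_case
    (h : ∀ (X : Scheme.{u}) [IsNoetherian X], Scheme.IsRegular X →
      ∀ (Es : List X.IdealSheafData), HasSNC Es → Es.Nodup →
      ∀ (𝒦 : List (List (X.IdealSheafData × ℕ))), (∀ K ∈ 𝒦, boundaryOf K = Es) → 𝒦 ≠ [] →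
        ∃ s : CentreSeq X, s.AllRegular ∧ s.CentresOver ((monomialSum 𝒦).support : Set X) ∧
          Scheme.IsRegular s.top ∧ IsLocallyPrincipal ((monomialSum 𝒦).comap s.comp)) :
    DepthTargets.MonomialSumPrincipalization.{u} := by
  intro X _ hX Es hEs 𝒦 hb hne
  have hsnc : HasSNC Es.dedup := HasSNCWith.of_forall_mem_iff (fun D => List.mem_dedup) hEs
  have hne' : 𝒦.map (collect Es.dedup) ≠ [] := by simpa using hne
  obtain ⟨s, hreg, hover, htop, hlp⟩ := h X hX Es.dedup hsnc (List.nodup_dedup Es) (𝒦.map (collect Es.dedup))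
    (fun K hK => by
      obtain ⟨A, -, rfl⟩ := List.mem_map.mp hK
      exact boundaryOf_collect _ _) hne'
  rw [monomialSum_map_collect hb] at hover hlp
  exact ⟨s, hreg, hover, htop, hlp⟩

/-- **M2 BY NAME FROM THE POLYHEDRA GAME**: res-type-075's combinatorial target
`PolyhedraGame.GlobalPermissiblePolyhedraGame` (p507620) implies the planner's M2
`DepthTargets.MonomialSumPrincipalization` (p502939) — principalization of every finite sum of monomial
ideals on a simple normal crossings boundary of a Noetherian regular scheme by blowing up regular
centres (strata) over the cosupport of the sum, with regular top.  Hence R-mono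
(`DepthTargets.monomial_of_targets` with M1 `monomialFormat_holds`, M3 `closedPointTower_holds`, D5)
is a tree theorem modulo the game alone. [cite: Kollar2007, (3.111) Step 3] [cite: Spivakovsky1983] -/
theorem monomialSumPrincipalization_of_game (hG : PolyhedraGame.GlobalPermissiblePolyhedraGame) :
    DepthTargets.MonomialSumPrincipalization.{u} :=
  monomialSumPrincipalization_of_nodup_case (monomialSumPrincipalization_of_game_of_nodup hG)

end MonomialCleanup

end Summit.ResolutionOfSingularities.ResolutionOfSingularities.Theorems

end
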